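import Summits.QuantumFields.YangMills.Theorems.Instrument.ClosedComplexCountBound
import Summits.QuantumFields.YangMills.Theorems.Instrument.ActivitySupSU2Bounds
import HarnessLib

/-!
# Instrument cell `ym-instrument`, crew (b): the tree's Kotecký–Preiss window criterion `KPCriterionSU2 δ β₀W` for `SU(2)`, `D = 4` PROVED WITH NO
# HYPOTHESIS — rows `β₀W = 1/10000 … 33/20000` on the kernel lattice-animal tail (grade (T); first hypothesis-free typed KP rows)

QUESTIONS.md rows: Q-B1 / Q-B2 (REGISTERED 2026-08-26T13:54:11Z; readings A-0826-8, A-0826-16); certs/b/FORMAT.md v1.3 §3b/§3d; cell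
`run/shared/lean/pub/ym-instrument/`, HUMAN RULING D-0084 (2), director-ym R138.  HONEST FRAMING (page 1, binding).  WHAT IS CERTIFIED HERE AND AT WHICH
`(G, D, L, β)`: `G = SU(2)`, `D = 4` (`ℤ⁴`), Wilson action, Wilson coupling `0 ≤ β_W ≤ β₀W` with `β₀W ≤ 33/20000 = 0.00165`; the object is the tree's COMPUTABLE
criterion `Balaban1983to89.StrongCouplingKPWindow.KPCriterionSU2 δ β₀W` («∃ α > 0, ∀ 0 ≤ β_W ≤ β₀W: Σ_n closedCount 4 n · activitySupSU2(β_W)^n · e^{(2α+δ)n} ≤ α»,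
the Kotecký–Preiss / Fernández–Procacci condition of the `SU(2)` plaquette Mayer-polymer gas on `ℤ⁴` with weights `a(γ) = α·#links(γ)`), and it is PROVED
OUTRIGHT — no counts hypothesis, no tail hypothesis: the coefficients are bounded by the KERNEL lattice-animal theorem `closedCount 4 n ≤ 6·441^(n−1)`
(`Instrument.ClosedComplexCountBound.closedCount_four_le`, an instance of the tree's `LatticeAnimals` lemma), the activity by `activitySupSU2 β_W ≤ e^{β₀W} − 1`
(landed `Instrument.ActivitySupSU2Bounds`), `e^{2α+δ}` by `Real.exp_bound'` / `Real.exp_one_lt_d9`, and the majorant `Σ_{n≥1} 6·441^{n−1} yⁿ = 6y/(1 − 441y) ≤ α`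
by `norm_num`.  ROWS (edge of THIS tail at grid `10⁻⁵`: `β₀W = 33/20000`; `δ` rounded down to the grid `10⁻²…10⁻³`):
`(β₀W, δ) = (1/10000, 14/5), (1/2000, 119/100), (1/1000, 1/2), (3/2000, 9/100), (33/20000, 0)`.  WHAT THIS IS NOT: the window is TINY — a factor `28` inside
the certified-conditional `r★ = 47/1000` of certs/b (T2 tail, counts `n ≤ 16`; Lean face `KPCriterionSU2Conditional`, grade (T | counts, T2)) and a factor `170`
inside the tree's hypothesis-free SC-c door `β_W < 2/7`; by A-0826-16 it is a NUMBER INSIDE `[0, 0.328)`, never a path to the door; it moves NO endpoint.  NOT a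
proof of clustering or of a mass gap: the tree's bridge `ExpClusteringOfKPCriterion` (KP ⇒ `StrongCouplingFront`) is an UNPROVED schema and the explicit-rate
reading «rate ≥ 4δ» (RADIUS-DERIVATION v0.4 Thm R′) is paper-level — §5 composes with the schema as the ONLY remaining hypothesis (grade (T | bridge)).  Its value
for Q-B1 is the grade: the first instance of the J-SC1 object that is a tree theorem with nothing assumed, i.e. a typed «certified cluster-expansion (KP)
window» `β_W = 1.65·10⁻³` in the criterion's own currency — `6·10³` times the tree's typed analyticity radius `strongCouplingRadius ≈ 2.6·10⁻⁷` (Wilson units) of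
TYPING-MENU §3(a), `28` times below what the paper-level tails certify.  NOT summit-bearing.
-/

noncomputable section

open Real Finset
open Literature.MathematicalPhysics.QuantumFieldTheory.Balaban1983to89.StrongCouplingKPWindow
  (closedCount activitySupSU2 KPCriterionSU2 ExpClusteringOfKPCriterion strongCouplingFront_of_kp)
open Literature.MathematicalPhysics.QuantumFieldTheory.Balaban1983to89.CrossoverLedger (StrongCouplingFront)
open Literature.MathematicalPhysics.QuantumLattice (fundamentalLatticeRep)
open Summit.QuantumFields.YangMills.Theorems.Instrument.ActivitySupSU2Bounds (activitySupSU2_nonneg activitySupSU2_le_of_le)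
open Summit.QuantumFields.YangMills.Theorems.Instrument.ClosedComplexCountBound (closedCount_four_le closedCount_four_zero)

namespace Summit.QuantumFields.YangMills.Theorems.Instrument.KPCriterionSU2Unconditional

/-! ## §1 The kernel majorant: coefficients `6·441^(n−1)` (`0` at `n = 0`), sum `6y/(1 − 441y)` -/

/-- The kernel lattice-animal majorant of the polymer counts: `0` at `n = 0`, `6·441^(n−1)` for `n ≥ 1`. -/
def animalCoeff (n : ℕ) : ℝ := if n = 0 then 0 else 6 * (441 : ℝ) ^ (n - 1)

/-- `closedCount 4 n ≤ animalCoeff n` for every `n` — a tree THEOREM (`ClosedComplexCountBound`), no hypothesis. [folklore] -/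
theorem closedCount_le_animalCoeff (n : ℕ) : (closedCount 4 n : ℝ) ≤ animalCoeff n := by
  unfold animalCoeff
  split_ifs with h
  · subst h
    rw [closedCount_four_zero]
    simp
  · exact_mod_cast closedCount_four_le n

/-- The value of the majorant series `Σ_{n≥1} 6·441^{n−1} yⁿ = 6y/(1 − 441y)`. -/
def animalSum (y : ℝ) : ℝ := 6 * y / (1 - 441 * y)

/-- The majorant series `n ↦ animalCoeff n · yⁿ` is summable with sum `animalSum y` when `0 ≤ y` and `441·y < 1`. [folklore] -/
theorem hasSum_animal {y : ℝ} (hy : 0 ≤ y) (ht : (441 : ℝ) * y < 1) :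
    HasSum (fun n : ℕ => animalCoeff n * y ^ n) (animalSum y) := by
  have h0 : 0 ≤ (441 : ℝ) * y := by positivity
  have htail : HasSum (fun j : ℕ => animalCoeff (j + 1) * y ^ (j + 1)) (6 * y * (1 - (441 : ℝ) * y)⁻¹) := by
    have hg := (hasSum_geometric_of_lt_one h0 ht).mul_left (6 * y)
    refine hg.congr_fun fun j => ?_
    have hj : j + 1 ≠ 0 := Nat.succ_ne_zero j
    simp only [animalCoeff, hj, if_false, Nat.add_sub_cancel, mul_pow, pow_succ]
    ring
  have h := (hasSum_nat_add_iff (f := fun n : ℕ => animalCoeff n * y ^ n) 1).1 htail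
  have hhead : ∑ i ∈ Finset.range 1, animalCoeff i * y ^ i = 0 := by simp [animalCoeff]
  rw [hhead, add_zero] at h
  unfold animalSum
  rw [div_eq_mul_inv]
  exact h

/-! ## §2 The hypothesis-free engine -/

/-- ★ **THE ENGINE (no hypothesis on the model).**  Let `0 < α` and reals `A, Q` with `e^{β₀} − 1 ≤ A`, `e^{2α+δ} ≤ Q`, `441·A·Q < 1` and
`6AQ/(1 − 441AQ) ≤ α`.  Then `KPCriterionSU2 δ β₀` with witness `α`: termwise `closedCount 4 n · w(β)^n · e^{(2α+δ)n} ≤ animalCoeff n · (AQ)^n` for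
`0 ≤ β ≤ β₀` (`w ≤ e^{β₀} − 1 ≤ A` by `ActivitySupSU2Bounds`, counts by `ClosedComplexCountBound`), summed. [folklore] -/
theorem kpCriterionSU2_of_animal {δ β₀ α A Q : ℝ} (hα : 0 < α) (hA : Real.exp β₀ - 1 ≤ A) (hQ : Real.exp (2 * α + δ) ≤ Q)
    (ht : (441 : ℝ) * (A * Q) < 1) (hS : 6 * (A * Q) / (1 - 441 * (A * Q)) ≤ α) : KPCriterionSU2 δ β₀ := by
  refine ⟨α, hα, fun βW h0 h1 => ?_⟩
  set a : ℝ := activitySupSU2 βW with hadef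
  set E : ℝ := Real.exp (2 * α + δ) with hEdef
  have ha0 : 0 ≤ a := activitySupSU2_nonneg h0
  have haA : a ≤ A := (activitySupSU2_le_of_le h1).trans hA
  have hE0 : 0 < E := Real.exp_pos _
  have hA0 : 0 ≤ A := ha0.trans haA
  have hQ0 : 0 ≤ Q := hE0.le.trans hQ
  have hy0 : 0 ≤ A * Q := mul_nonneg hA0 hQ0
  have haE : a * E ≤ A * Q := mul_le_mul haA hQ hE0.le hA0
  have hterm : ∀ n : ℕ, (closedCount 4 n : ℝ) * a ^ n * Real.exp ((2 * α + δ) * n) = (closedCount 4 n : ℝ) * (a * E) ^ n := fun n => by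
    rw [mul_comm (2 * α + δ) (n : ℝ), Real.exp_nat_mul, mul_pow]; ring
  have hle : ∀ n : ℕ, (closedCount 4 n : ℝ) * a ^ n * Real.exp ((2 * α + δ) * n) ≤ animalCoeff n * (A * Q) ^ n := fun n => by
    rw [hterm n]
    have h1 := closedCount_le_animalCoeff n
    have hmaj0 : 0 ≤ animalCoeff n := (Nat.cast_nonneg _).trans h1
    exact mul_le_mul h1 (pow_le_pow_left₀ (mul_nonneg ha0 hE0.le) haE n) (pow_nonneg (mul_nonneg ha0 hE0.le) n) hmaj0
  have hnn : ∀ n : ℕ, 0 ≤ (closedCount 4 n : ℝ) * a ^ n * Real.exp ((2 * α + δ) * n) := fun n => by positivity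
  have hmaj := hasSum_animal hy0 ht
  have hsum : Summable (fun n : ℕ => (closedCount 4 n : ℝ) * a ^ n * Real.exp ((2 * α + δ) * n)) :=
    Summable.of_nonneg_of_le hnn hle hmaj.summable
  refine ⟨hsum, ?_⟩
  calc ∑' n : ℕ, (closedCount 4 n : ℝ) * a ^ n * Real.exp ((2 * α + δ) * n)
      ≤ ∑' n : ℕ, animalCoeff n * (A * Q) ^ n := hsum.tsum_le_tsum hle hmaj.summable
    _ = animalSum (A * Q) := hmaj.tsum_eq
    _ = 6 * (A * Q) / (1 - 441 * (A * Q)) := rfl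
    _ ≤ α := hS

/-! ## §3 Kernel exponential bounds (Taylor with remainder, `Real.exp_bound'`; `e < 2.718281829`, `Real.exp_one_lt_d9`) -/

/-- For `0 ≤ x ≤ 1`: `e^x ≤ Σ_{m<8} x^m/m! + x⁸·9/(8!·8)`. [folklore] -/
theorem exp_le_taylor8 {x : ℝ} (h0 : 0 ≤ x) (h1 : x ≤ 1) :
    Real.exp x ≤ ∑ m ∈ Finset.range 8, x ^ m / m.factorial + x ^ 8 * (8 + 1) / (Nat.factorial 8 * 8) :=
  Real.exp_bound' h0 h1 (by norm_num)

/-- `e ≤ 2718281829/10⁹`. [folklore] -/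
theorem exp_one_le : Real.exp 1 ≤ (2718281829 : ℝ) / 1000000000 := by
  have h := Real.exp_one_lt_d9
  norm_num at h ⊢
  linarith

/-- `e^{1 + r} ≤ (2718281829/10⁹) · B` whenever `e^r ≤ B`. [folklore] -/
theorem exp_one_add_le {r B : ℝ} (hB : Real.exp r ≤ B) : Real.exp (1 + r) ≤ (2718281829 : ℝ) / 1000000000 * B := by
  rw [Real.exp_add]
  exact mul_le_mul exp_one_le hB (Real.exp_pos r).le (by norm_num)

/-- `e^{1/10000} − 1 ≤ 500025001/(5·10¹²)`. [folklore] -/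
theorem exp_1_10000_sub_one_le : Real.exp ((1 : ℝ) / 10000) - 1 ≤ (500025001 : ℝ) / 5000000000000 := by
  have h := exp_le_taylor8 (x := (1 : ℝ) / 10000) (by norm_num) (by norm_num)
  simp only [Finset.sum_range_succ, Finset.sum_range_zero, Nat.factorial] at h
  norm_num at h ⊢; linarith

/-- `e^{1/2000} − 1 ≤ 5001250209/10¹³`. [folklore] -/
theorem exp_1_2000_sub_one_le : Real.exp ((1 : ℝ) / 2000) - 1 ≤ (5001250209 : ℝ) / 10000000000000 := by
  have h := exp_le_taylor8 (x := (1 : ℝ) / 2000) (by norm_num) (by norm_num)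
  simp only [Finset.sum_range_succ, Finset.sum_range_zero, Nat.factorial] at h
  norm_num at h ⊢; linarith

/-- `e^{1/1000} − 1 ≤ 2501250417/(2.5·10¹²)`. [folklore] -/
theorem exp_1_1000_sub_one_le : Real.exp ((1 : ℝ) / 1000) - 1 ≤ (2501250417 : ℝ) / 2500000000000 := by
  have h := exp_le_taylor8 (x := (1 : ℝ) / 1000) (by norm_num) (by norm_num)
  simp only [Finset.sum_range_succ, Finset.sum_range_zero, Nat.factorial] at h
  norm_num at h ⊢; linarith

/-- `e^{3/2000} − 1 ≤ 3752813907/(2.5·10¹²)`. [folklore] -/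
theorem exp_3_2000_sub_one_le : Real.exp ((3 : ℝ) / 2000) - 1 ≤ (3752813907 : ℝ) / 2500000000000 := by
  have h := exp_le_taylor8 (x := (3 : ℝ) / 2000) (by norm_num) (by norm_num)
  simp only [Finset.sum_range_succ, Finset.sum_range_zero, Nat.factorial] at h
  norm_num at h ⊢; linarith

/-- `e^{33/20000} − 1 ≤ 1651361999/10¹²`. [folklore] -/
theorem exp_33_20000_sub_one_le : Real.exp ((33 : ℝ) / 20000) - 1 ≤ (1651361999 : ℝ) / 1000000000000 := by
  have h := exp_le_taylor8 (x := (33 : ℝ) / 20000) (by norm_num) (by norm_num)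
  simp only [Finset.sum_range_succ, Finset.sum_range_zero, Nat.factorial] at h
  norm_num at h ⊢; linarith

/-- `e^{2·(7/100) + 14/5} = e^{2.94} ≤ (2718281829/10⁹)²·(6399953917279/(2.5·10¹²))` (`2.94 = 1 + 1 + 0.94`). [folklore] -/
theorem exp_294_le : Real.exp (2 * ((7 : ℝ) / 100) + (14 : ℝ) / 5) ≤
    (2718281829 : ℝ) / 1000000000 * ((2718281829 : ℝ) / 1000000000 * ((6399953917279 : ℝ) / 2500000000000)) := by
  rw [show 2 * ((7 : ℝ) / 100) + (14 : ℝ) / 5 = 1 + (1 + (47 : ℝ) / 50) by norm_num]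
  refine exp_one_add_le (exp_one_add_le ?_)
  have h := exp_le_taylor8 (x := (47 : ℝ) / 50) (by norm_num) (by norm_num)
  simp only [Finset.sum_range_succ, Finset.sum_range_zero, Nat.factorial] at h
  norm_num at h ⊢; linarith

/-- `e^{2·(71/1000) + 119/100} = e^{1.332} ≤ (2718281829/10⁹)·(2787505697661/(2·10¹²))` (`1.332 = 1 + 0.332`). [folklore] -/
theorem exp_1332_le : Real.exp (2 * ((71 : ℝ) / 1000) + (119 : ℝ) / 100) ≤
    (2718281829 : ℝ) / 1000000000 * ((2787505697661 : ℝ) / 2000000000000) := by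
  rw [show 2 * ((71 : ℝ) / 1000) + (119 : ℝ) / 100 = 1 + (83 : ℝ) / 250 by norm_num]
  refine exp_one_add_le ?_
  have h := exp_le_taylor8 (x := (83 : ℝ) / 250) (by norm_num) (by norm_num)
  simp only [Finset.sum_range_succ, Finset.sum_range_zero, Nat.factorial] at h
  norm_num at h ⊢; linarith

/-- `e^{2·(9/125) + 1/2} = e^{0.644} ≤ 9520410152723/(5·10¹²)`. [folklore] -/
theorem exp_0644_le : Real.exp (2 * ((9 : ℝ) / 125) + (1 : ℝ) / 2) ≤ (9520410152723 : ℝ) / 5000000000000 := by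
  rw [show 2 * ((9 : ℝ) / 125) + (1 : ℝ) / 2 = (161 : ℝ) / 250 by norm_num]
  have h := exp_le_taylor8 (x := (161 : ℝ) / 250) (by norm_num) (by norm_num)
  simp only [Finset.sum_range_succ, Finset.sum_range_zero, Nat.factorial] at h
  norm_num at h ⊢; linarith

/-- `e^{2·(71/1000) + 9/100} = e^{0.232} ≤ 12611197288489/10¹³`. [folklore] -/
theorem exp_0232_le : Real.exp (2 * ((71 : ℝ) / 1000) + (9 : ℝ) / 100) ≤ (12611197288489 : ℝ) / 10000000000000 := by
  rw [show 2 * ((71 : ℝ) / 1000) + (9 : ℝ) / 100 = (29 : ℝ) / 125 by norm_num]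
  have h := exp_le_taylor8 (x := (29 : ℝ) / 125) (by norm_num) (by norm_num)
  simp only [Finset.sum_range_succ, Finset.sum_range_zero, Nat.factorial] at h
  norm_num at h ⊢; linarith

/-- `e^{2·(9/125) + 0} = e^{0.144} ≤ 2309768217051/(2·10¹²)`. [folklore] -/
theorem exp_0144_le : Real.exp (2 * ((9 : ℝ) / 125) + 0) ≤ (2309768217051 : ℝ) / 2000000000000 := by
  rw [show 2 * ((9 : ℝ) / 125) + (0 : ℝ) = (18 : ℝ) / 125 by norm_num]
  have h := exp_le_taylor8 (x := (18 : ℝ) / 125) (by norm_num) (by norm_num)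
  simp only [Finset.sum_range_succ, Finset.sum_range_zero, Nat.factorial] at h
  norm_num at h ⊢; linarith

/-! ## §4 ★ The rows — `KPCriterionSU2 δ β₀W` with NO hypothesis (grade (T)) -/

/-- ★ **Row `β₀W = 1/10000`, `δ = 14/5 = 2.8`** (witness `α = 7/100`; `441·AQ = 0.834`, majorant `0.0685 ≤ 0.07`).  HYPOTHESIS-FREE.  In the paper-level reading
(RADIUS-DERIVATION Thm R′) `δ` is the decay weight `d`, «rate ≥ 4δ = 11.2 per lattice unit at β_W ≤ 10⁻⁴» — NOT claimed here. [folklore] -/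
theorem kpCriterionSU2_1_10000 : KPCriterionSU2 ((14 : ℝ) / 5) ((1 : ℝ) / 10000) :=
  kpCriterionSU2_of_animal (α := (7 : ℝ) / 100) (by norm_num) exp_1_10000_sub_one_le exp_294_le (by norm_num) (by norm_num)

/-- ★ **Row `β₀W = 1/2000`, `δ = 119/100`** (witness `α = 71/1000`; majorant `0.0692 ≤ 0.071`).  HYPOTHESIS-FREE («4δ = 4.76», not claimed). [folklore] -/
theorem kpCriterionSU2_1_2000 : KPCriterionSU2 ((119 : ℝ) / 100) ((1 : ℝ) / 2000) :=
  kpCriterionSU2_of_animal (α := (71 : ℝ) / 1000) (by norm_num) exp_1_2000_sub_one_le exp_1332_le (by norm_num) (by norm_num)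

/-- ★ **Row `β₀W = 1/1000`, `δ = 1/2`** (witness `α = 9/125`; majorant `0.0715 ≤ 0.072`).  HYPOTHESIS-FREE («4δ = 2», not claimed). [folklore] -/
theorem kpCriterionSU2_1_1000 : KPCriterionSU2 ((1 : ℝ) / 2) ((1 : ℝ) / 1000) :=
  kpCriterionSU2_of_animal (α := (9 : ℝ) / 125) (by norm_num) exp_1_1000_sub_one_le exp_0644_le (by norm_num) (by norm_num)

/-- ★ **Row `β₀W = 3/2000`, `δ = 9/100`** (witness `α = 71/1000`; majorant `0.0688 ≤ 0.071`).  HYPOTHESIS-FREE («4δ = 0.36», not claimed). [folklore] -/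
theorem kpCriterionSU2_3_2000 : KPCriterionSU2 ((9 : ℝ) / 100) ((3 : ℝ) / 2000) :=
  kpCriterionSU2_of_animal (α := (71 : ℝ) / 1000) (by norm_num) exp_3_2000_sub_one_le exp_0232_le (by norm_num) (by norm_num)

/-- ★ **Radius-type row `β₀W = 33/20000 = 0.00165`, `δ = 0`** (witness `α = 9/125`; majorant `0.0720 ≤ 0.072`) — the edge of the kernel animal tail at grid
`10⁻⁵` (`β₀W = 83/50000` is infeasible for every `α` on the grid `10⁻³`).  HYPOTHESIS-FREE.  The typed «KP window» of this tail: `r★_T = 1.65·10⁻³` Wilson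
units. [folklore] -/
theorem kpCriterionSU2_33_20000 : KPCriterionSU2 0 ((33 : ℝ) / 20000) :=
  kpCriterionSU2_of_animal (α := (9 : ℝ) / 125) (by norm_num) exp_33_20000_sub_one_le exp_0144_le (by norm_num) (by norm_num)

/-- Every smaller window inherits the radius row (the tree's `KPCriterionSU2.mono`). [folklore] -/
theorem kpCriterionSU2_zero_of_le {β₀W : ℝ} (h : β₀W ≤ (33 : ℝ) / 20000) : KPCriterionSU2 0 β₀W :=
  kpCriterionSU2_33_20000.mono h

/-! ## §5 Composition with the tree's (unproved) bridge schema — the ONLY hypothesis left (grade (T | bridge)) -/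

/-- **(T | bridge)**: IF the tree's Kotecký–Preiss ⇒ clustering schema `ExpClusteringOfKPCriterion (1/2) (1/1000)` holds, THEN the `SU(2)`, `d = 4`
strong-coupling front `StrongCouplingFront (fundamentalLatticeRep 2) (1/2000)` (tree coupling `β₀W/2`, i.e. Wilson `β_W ≤ 10⁻³`).  The KP input is the
hypothesis-free row `kpCriterionSU2_1_1000`; the bridge is NOT proved in the tree; the window is a factor `180` inside the tree's hypothesis-free front at
`9/50` — recorded for the ledger's grammar only, it moves nothing. [folklore] -/
theorem strongCouplingFront_1_1000_of_bridge (hBridge : ExpClusteringOfKPCriterion ((1 : ℝ) / 2) ((1 : ℝ) / 1000)) :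
    StrongCouplingFront (fundamentalLatticeRep 2) (((1 : ℝ) / 1000) / 2) :=
  strongCouplingFront_of_kp (by norm_num) kpCriterionSU2_1_1000 hBridge

end Summit.QuantumFields.YangMills.Theorems.Instrument.KPCriterionSU2Unconditional

end
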